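import Mathlib
import Summits.Ventures.HodgeRepro.Tier4.Common.AdelicRTF
import Summits.Ventures.HodgeRepro.Tier4.Common.LocalTorus
import Summits.Ventures.HodgeRepro.Tier4.Common.CompactOpenLevel
import Summits.Ventures.HodgeRepro.Tier4.Line1.FiniteLevelIsolation
import Summits.Ventures.HodgeRepro.Tier4.Line1.LocallyCompactGA
import Summits.Ventures.HodgeRepro.Tier4.Line1.SecondCountableGA
import Summits.Ventures.HodgeRepro.Tier4.Line1.SigmaCompactGA
import Summits.Ventures.HodgeRepro.Tier4.Line4.FinitePlacePositivity
import Summits.Ventures.HodgeRepro.Tier4.Line4.FinitePartSplit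

/-!
# Tier4/Line4/TorusProduct — C-L4-TORUSPROD (Parts 0–1): the adelic torus as the product of its archimedean and finite parts

Blind re-derivation cell `pub-hodge-repro`, Tier 4 «PROVE THE STEP» (README §9–§10), LINE L4, seat t4-L2-p1 g2 on
t4-plan-4 g3's cut C-L4-TORUSPROD (S14382 / S14416 / S14521; statements VERBATIM from
proofs/t4-plan-4/work/TorusProduct-STATEMENTS-v2.lean) and the PARTS stubs of S14443.  The Haar half of the cut
((5)–(7) and the `T′` twins) is the companion module `Tier4/Line4/TorusProductHaar.lean` (the ≤ 400-line rule).

* The archimedean-part laws `GA.ofInfPart`: `ofInfPart_one`, `ofInfPart_mul`, `ofInfPart_inv`, `continuous_ofInfPart` (the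
  twins of FINPOS's `ofFinPart_*`), the membership laws (`ofFinPart_mem_finitePart`; `ofInfPart_mem_torusT(')` and
  `ofInfPart_mem_commutant` are L2-p3's, FinitePartSplit p692938, consumed by name), `ofInfPart_eq_self_of_mem_infinitePart`, `ofInfPart_eq_one_of_mem_finitePart`, `ofFinPart_eq_self_of_mem_finitePart`,
  `ofFinPart_eq_one_of_mem_infinitePart`) — all through `M4_ext` and the `mixM` / `finM` / `infM` calculus of AdelicParts.
* **`torusSplit : T(𝔸) ≃ₜ* T_∞ × T_f`**, `t ↦ (t_∞, t_f)` = `(infTInf W t, finTf W t)` (the subgroup-valued projections;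
  `infTInf` is the statements file's `infT`, renamed because L2-p3's `infT : T(𝔸) → T(𝔸)` already holds that name), inverse
  `(a, b) ↦ a b` (`GA.ofInfPart_mul_ofFinPart`; the laws above give `right_inv` and `map_mul`), and the `T′` twin `torusSplit'`.

Nothing here asserts the wall; the factorisation cuts downstream (UNFOLD-Z, FINPOS′, FINSUM, INNERSPLIT, WFIBRE / W0REL)
consume these by name.  No printed input.  Nothing here says anything about the status of the Hodge conjecture for CM
abelian varieties, which is NOT proved (HC_CM is NOT proved by anyone in this repository).
-/

set_option autoImplicit false

noncomputable section

namespace Summit.Ventures.HodgeRepro.Tier4.Line4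

open Summit.Ventures.HodgeRepro.Tier4 Summit.Ventures.HodgeRepro.Tier4.Common
  Summit.Ventures.HodgeRepro.Tier4.Line1 MeasureTheory
open scoped ComplexConjugate Topology Pointwise NNReal NumberField

variable {k : Type} [Field k] [NumberField k] (W : PlaneData k)

/-! ### The archimedean-part laws (twins of FINPOS's finite-part laws) -/

/-- The archimedean part of `1` is `1`. -/
theorem ofInfPart_one : GA.ofInfPart W 1 = 1 := by
  apply Subtype.ext
  apply Units.ext
  change GA.mat W (GA.ofInfPart W 1) = (1 : M4 k)
  have h1 : GA.mat W (1 : GA W) = (1 : M4 k) := rfl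
  rw [GA.mat_ofInfPart, h1]
  apply M4_ext
  · rw [infM_mixM]
  · rw [finM_mixM, finM_one]

/-- The archimedean part of a product is the product of the archimedean parts. -/
theorem ofInfPart_mul (g h : GA W) : GA.ofInfPart W (g * h) = GA.ofInfPart W g * GA.ofInfPart W h := by
  apply Subtype.ext
  apply Units.ext
  change GA.mat W (GA.ofInfPart W (g * h)) = GA.mat W (GA.ofInfPart W g) * GA.mat W (GA.ofInfPart W h)
  rw [GA.mat_ofInfPart, GA.mat_ofInfPart, GA.mat_ofInfPart, GA.mat_mul]
  apply M4_ext
  · simp only [infM_mul, infM_mixM]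
  · simp only [finM_mul, finM_mixM, Matrix.one_mul]

/-- The archimedean part of an inverse is the inverse of the archimedean part. -/
theorem ofInfPart_inv (g : GA W) : GA.ofInfPart W g⁻¹ = (GA.ofInfPart W g)⁻¹ := by
  apply eq_inv_of_mul_eq_one_left
  rw [← ofInfPart_mul, inv_mul_cancel, ofInfPart_one]

/-- The infinite part of an element of `G(𝔸_f)` is the identity matrix. -/
theorem infM_eq_one_of_mem_finitePart {g : GA W} (hg : g ∈ finitePart W) : infM k (GA.mat W g) = 1 := by
  rw [← infM_one (k := k)]
  refine Matrix.ext fun i j => ?_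
  simp only [infM, Matrix.map_apply]
  have := infPart_entry_sub_one_eq_zero W hg i j
  rwa [Matrix.sub_apply, map_sub, sub_eq_zero] at this

/-- (2) the finite part has trivial archimedean components. -/
theorem ofFinPart_mem_finitePart (g : GA W) : GA.ofFinPart W g ∈ finitePart W := by
  intro w
  apply Units.ext
  refine Matrix.ext fun i j => ?_
  change adComponentInf k w (GA.mat W (GA.ofFinPart W g) i j) = (1 : Matrix (Fin 4) (Fin 4) w.Completion) i j
  rw [GA.mat_ofFinPart]
  by_cases hij : i = j
  · subst hij
    simp only [mixM, adComponentInf, Matrix.of_apply, Matrix.one_apply_eq]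
    rfl
  · simp only [mixM, adComponentInf, Matrix.of_apply, Matrix.one_apply_ne hij]
    rfl

/-- The archimedean part of an element of `G_∞` is the element itself. -/
theorem ofInfPart_eq_self_of_mem_infinitePart {g : GA W} (hg : g ∈ infinitePart W) : GA.ofInfPart W g = g := by
  apply Subtype.ext
  apply Units.ext
  change GA.mat W (GA.ofInfPart W g) = GA.mat W g
  rw [GA.mat_ofInfPart]
  apply M4_ext
  · rw [infM_mixM]
  · rw [finM_mixM, (mem_infinitePart W g).1 hg]

/-- The archimedean part of an element of `G(𝔸_f)` is `1`. -/
theorem ofInfPart_eq_one_of_mem_finitePart {g : GA W} (hg : g ∈ finitePart W) : GA.ofInfPart W g = 1 := by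
  apply Subtype.ext
  apply Units.ext
  change GA.mat W (GA.ofInfPart W g) = (1 : M4 k)
  rw [GA.mat_ofInfPart]
  apply M4_ext
  · rw [infM_mixM, infM_eq_one_of_mem_finitePart W hg, infM_one]
  · rw [finM_mixM, finM_one]

/-- The finite part of an element of `G(𝔸_f)` is the element itself. -/
theorem ofFinPart_eq_self_of_mem_finitePart {g : GA W} (hg : g ∈ finitePart W) : GA.ofFinPart W g = g := by
  apply Subtype.ext
  apply Units.ext
  change GA.mat W (GA.ofFinPart W g) = GA.mat W g
  rw [GA.mat_ofFinPart]
  apply M4_ext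
  · rw [infM_mixM, infM_eq_one_of_mem_finitePart W hg]
  · rw [finM_mixM]

/-- The finite part of an element of `G_∞` is `1`. -/
theorem ofFinPart_eq_one_of_mem_infinitePart {g : GA W} (hg : g ∈ infinitePart W) : GA.ofFinPart W g = 1 := by
  apply Subtype.ext
  apply Units.ext
  change GA.mat W (GA.ofFinPart W g) = (1 : M4 k)
  rw [GA.mat_ofFinPart]
  apply M4_ext
  · rw [infM_mixM, infM_one]
  · rw [finM_mixM, (mem_infinitePart W g).1 hg, finM_one]

/-- (3) `ofInfPart` is continuous (twin of `continuous_ofFinPart`). -/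
theorem continuous_ofInfPart : Continuous (GA.ofInfPart W) := by
  have hmat : Continuous fun g : GA W => GA.mat W g := Units.continuous_val.comp continuous_subtype_val
  have hmatinv : Continuous fun g : GA W => GA.mat W g⁻¹ := by
    have h1 : Continuous fun g : GA W => ((g : GL4 k)⁻¹ : GL4 k) := continuous_inv.comp continuous_subtype_val
    exact Units.continuous_val.comp h1
  have hmix : ∀ F : GA W → M4 k, Continuous F → Continuous fun g => mixM k (infM k (F g)) 1 := by
    intro F hF
    refine continuous_matrix fun i j => ?_
    show Continuous fun g => (infPart k (F g i j), (1 : Matrix (Fin 4) (Fin 4) (IsDedekindDomain.FiniteAdeleRing (𝓞 k) k)) i j)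
    exact (continuous_infPart.comp (hF.matrix_elem i j)).prodMk continuous_const
  refine Continuous.subtype_mk ?_ _
  refine Units.continuous_iff.2 ⟨?_, ?_⟩
  · exact hmix (fun g => GA.mat W g) hmat
  · exact hmix (fun g => GA.mat W g⁻¹) hmatinv

/-! ### The splitting `T(𝔸) ≃ T_∞ × T_f` -/

/-- **The archimedean part of the torus** `T_∞ = T(𝔸) ∩ G_∞`, as a subgroup of `T(𝔸)` (cut C-L4-TORUSPROD (0)). -/
def torusInf : Subgroup (torusT W) := (infinitePart W).subgroupOf (torusT W)

/-- **The finite part of the torus** `T_f = T(𝔸) ∩ G(𝔸_f)`, as a subgroup of `T(𝔸)`. -/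
def torusFin : Subgroup (torusT W) := (finitePart W).subgroupOf (torusT W)

/-- The archimedean part of a torus element, in `T_∞`. -/
def infTInf (t : torusT W) : torusInf W :=
  ⟨⟨GA.ofInfPart W t, ofInfPart_mem_torusT W t.2⟩, by
    show GA.ofInfPart W (t : GA W) ∈ infinitePart W
    exact GA.ofInfPart_mem_infinitePart W _⟩

/-- The finite part of a torus element, in `T_f`. -/
def finTf (t : torusT W) : torusFin W :=
  ⟨⟨GA.ofFinPart W t, ofFinPart_mem_torusT W t.2⟩, by
    show GA.ofFinPart W (t : GA W) ∈ finitePart W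
    exact ofFinPart_mem_finitePart W _⟩

/-- `infTInf` is continuous. -/
theorem continuous_infTInf : Continuous (infTInf W) :=
  Continuous.subtype_mk (Continuous.subtype_mk ((continuous_ofInfPart W).comp continuous_subtype_val) _) _

/-- `finTf` is continuous. -/
theorem continuous_finTf : Continuous (finTf W) :=
  Continuous.subtype_mk (Continuous.subtype_mk ((continuous_ofFinPart W).comp continuous_subtype_val) _) _

/-- **THE SPLITTING `T(𝔸) ≃ T_∞ × T_f`** (cut C-L4-TORUSPROD (4)): `t ↦ (t_∞, t_f)`, inverse `(a, b) ↦ a · b`; a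
continuous group isomorphism (`GA.ofInfPart_mul_ofFinPart`, (1)–(3), and `G_∞` commutes with `G(𝔸_f)`). -/
def torusSplit : torusT W ≃ₜ* torusInf W × torusFin W where
  toFun t := (infTInf W t, finTf W t)
  invFun p := (p.1 : torusT W) * (p.2 : torusT W)
  left_inv := by
    intro t
    apply Subtype.ext
    exact GA.ofInfPart_mul_ofFinPart W (t : GA W)
  right_inv := by
    rintro ⟨a, b⟩
    have ha : (a : GA W) ∈ infinitePart W := a.2
    have hb : (b : GA W) ∈ finitePart W := b.2
    refine Prod.ext ?_ ?_
    · apply Subtype.ext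
      apply Subtype.ext
      change GA.ofInfPart W ((a : GA W) * (b : GA W)) = (a : GA W)
      rw [ofInfPart_mul, ofInfPart_eq_self_of_mem_infinitePart W ha, ofInfPart_eq_one_of_mem_finitePart W hb,
        mul_one]
    · apply Subtype.ext
      apply Subtype.ext
      change GA.ofFinPart W ((a : GA W) * (b : GA W)) = (b : GA W)
      rw [ofFinPart_mul, ofFinPart_eq_one_of_mem_infinitePart W ha, ofFinPart_eq_self_of_mem_finitePart W hb,
        one_mul]
  map_mul' := by
    intro s t
    refine Prod.ext ?_ ?_
    · apply Subtype.ext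
      apply Subtype.ext
      exact ofInfPart_mul W (s : GA W) (t : GA W)
    · apply Subtype.ext
      apply Subtype.ext
      exact ofFinPart_mul W (s : GA W) (t : GA W)
  continuous_toFun := (continuous_infTInf W).prodMk (continuous_finTf W)
  continuous_invFun := (continuous_subtype_val.comp continuous_fst).mul (continuous_subtype_val.comp continuous_snd)

/-! ## The `T′` twins (same statements on `torusT' W`; the downstream factorisation cuts consume both) -/

/-- The archimedean part of the torus `T′`. -/
def torusInf' : Subgroup (torusT' W) := (infinitePart W).subgroupOf (torusT' W)

/-- The finite part of the torus `T′`. -/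
def torusFin' : Subgroup (torusT' W) := (finitePart W).subgroupOf (torusT' W)

/-- The archimedean part of a `T′`-element, in `T′_∞`. -/
def infTInf' (t : torusT' W) : torusInf' W :=
  ⟨⟨GA.ofInfPart W t, ofInfPart_mem_torusT' W t.2⟩, by
    show GA.ofInfPart W (t : GA W) ∈ infinitePart W
    exact GA.ofInfPart_mem_infinitePart W _⟩

/-- The finite part of a `T′`-element, in `T′_f`. -/
def finTf' (t : torusT' W) : torusFin' W :=
  ⟨⟨GA.ofFinPart W t, ofFinPart_mem_torusT' W t.2⟩, by
    show GA.ofFinPart W (t : GA W) ∈ finitePart W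
    exact ofFinPart_mem_finitePart W _⟩

/-- `infTInf'` is continuous. -/
theorem continuous_infTInf' : Continuous (infTInf' W) :=
  Continuous.subtype_mk (Continuous.subtype_mk ((continuous_ofInfPart W).comp continuous_subtype_val) _) _

/-- `finTf'` is continuous. -/
theorem continuous_finTf' : Continuous (finTf' W) :=
  Continuous.subtype_mk (Continuous.subtype_mk ((continuous_ofFinPart W).comp continuous_subtype_val) _) _

/-- (4′) **THE SPLITTING `T′(𝔸) ≃ T′_∞ × T′_f`**. -/
def torusSplit' : torusT' W ≃ₜ* torusInf' W × torusFin' W where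
  toFun t := (infTInf' W t, finTf' W t)
  invFun p := (p.1 : torusT' W) * (p.2 : torusT' W)
  left_inv := by
    intro t
    apply Subtype.ext
    exact GA.ofInfPart_mul_ofFinPart W (t : GA W)
  right_inv := by
    rintro ⟨a, b⟩
    have ha : (a : GA W) ∈ infinitePart W := a.2
    have hb : (b : GA W) ∈ finitePart W := b.2
    refine Prod.ext ?_ ?_
    · apply Subtype.ext
      apply Subtype.ext
      change GA.ofInfPart W ((a : GA W) * (b : GA W)) = (a : GA W)
      rw [ofInfPart_mul, ofInfPart_eq_self_of_mem_infinitePart W ha, ofInfPart_eq_one_of_mem_finitePart W hb,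
        mul_one]
    · apply Subtype.ext
      apply Subtype.ext
      change GA.ofFinPart W ((a : GA W) * (b : GA W)) = (b : GA W)
      rw [ofFinPart_mul, ofFinPart_eq_one_of_mem_infinitePart W ha, ofFinPart_eq_self_of_mem_finitePart W hb,
        one_mul]
  map_mul' := by
    intro s t
    refine Prod.ext ?_ ?_
    · apply Subtype.ext
      apply Subtype.ext
      exact ofInfPart_mul W (s : GA W) (t : GA W)
    · apply Subtype.ext
      apply Subtype.ext
      exact ofFinPart_mul W (s : GA W) (t : GA W)
  continuous_toFun := (continuous_infTInf' W).prodMk (continuous_finTf' W)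
  continuous_invFun := (continuous_subtype_val.comp continuous_fst).mul (continuous_subtype_val.comp continuous_snd)

end Summit.Ventures.HodgeRepro.Tier4.Line4
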